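import Mathlib.Algebra.Group.MinimalAxioms
import Mathlib.Tactic.DeriveFintype
import Mathlib.GroupTheory.Index
import Summits.MatrixMultiplication.OmegaCensus.DihC3SqCoord

/-!
# ω-census, family (b3): the class `𝒞₂` — the group `Dih(C₃²)`, the coordinate homomorphism `π : G → Dih(C₃²)`, and the LOWER bound `α(G;|G|,3,3) ≥ (16/9)|G|`

HONEST FRAMING (pub-omega census; verbatim): lottery ticket; floor = certified bounds/negative ranges.
Census BOOKKEEPING (prereg P-031 / conjecture C9 (c) of the cell; pub-omega stpp-1 gen 17, the `Dih(C₃²)` construction by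
gen 14): everything about the class `𝒞₂ = {C₃² ⋊_ε C}` that does NOT need the kernel certificate of the fibre model
(`DihC3SqFinal`), so that it lands independently of it:
* `DihC3C3` — `Dih(C₃²) = C₃² ⋊ C₂` as a hand-built group type (triples `(a, b, s)`, axioms by `decide`), its coordinates
  `DihC3C3.coord2 : Coord2 …` (by `decide`);
* the engine's `32`-cell independent set in the box `Y = {1, c₁, c₂}`, `W = {1, c₁c₂, t}` of `Dih(C₃²)`, CHECKED in the kernel
  by Boolean list checks (`DihC3C3.exists_indep_32`; boxmis2 9b0cf7fc witness mode on the Cayley table generated from the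
  multiplication rule, element index `a + 3b + 9s`);
* `exists_indep_lift` — an independent cell set of a `3 × 3` box of `Q` lifts along any surjection `f : G →* Q` to one of
  `#I · |ker f|` cells of a `3 × 3` box of `G` (the construction of `BoxUseful.quotient`, C9 (a), for a general `f`);
* `Coord2.toDihHom` — the coordinates ARE a homomorphism `π = (κ₁, κ₂, [ε = −1]) : G →* Dih(C₃²)` (the cocycle law is the
  semidirect multiplication), onto as soon as some `ε = −1`, which a non-commuting pair provides (`exists_eps_neg_of_ne`: two
  elements of sign `+1` commute);
* **`Coord2.exists_indep_sixteen_ninths`** — hence every NON-ABELIAN `𝒞₂` group has a `3 × 3` box with an independent cell set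
  `J`, `9|J| = 16|G|`: the box ratio is AT LEAST `16/9` (C9 (c), lower side; the matching upper bound is THE LAW,
  `DihC3SqTPP`).
Nothing here is progress on `ω`.
-/

namespace Summit.MatrixMultiplication.OmegaCensus.DihC3Sq

open Finset

/-! ### `Dih(C₃²)` -/

/-- The generalised dihedral group `Dih(C₃²) = C₃² ⋊ C₂` (order `18`, trivial centre, `G' = C₃²`): elements `c₁^a c₂^b t^s` as triples.
[folklore] -/
structure DihC3C3 where
  /-- exponent of `c₁` -/
  a : ZMod 3
  /-- exponent of `c₂` -/
  b : ZMod 3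
  /-- exponent of the reflection `t` -/
  s : ZMod 2
  deriving DecidableEq, Fintype

namespace DihC3C3

/-- The sign `(−1)^s`. [folklore] -/
def sgn (s : ZMod 2) : ZMod 3 := if s = 0 then 1 else -1

/-- Twisted product `(v, s)(v', s') = (v + (−1)^s v', s + s')`. [folklore] -/
instance : Mul DihC3C3 := ⟨fun x y => ⟨x.a + sgn x.s * y.a, x.b + sgn x.s * y.b, x.s + y.s⟩⟩

/-- Identity. [folklore] -/
instance : One DihC3C3 := ⟨⟨0, 0, 0⟩⟩

/-- Inverse `(v, s)⁻¹ = (−(−1)^s v, s)`. [folklore] -/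
instance : Inv DihC3C3 := ⟨fun x => ⟨-(sgn x.s * x.a), -(sgn x.s * x.b), -x.s⟩⟩

/-- `Dih(C₃²)` is a group (axioms checked on the `18` elements). [folklore] -/
instance : Group DihC3C3 :=
  Group.ofLeftAxioms (by decide +kernel) (by decide +kernel) (by decide +kernel)

/-- Coordinate `κ₁ (a, b, s) = a`. [folklore] -/
def κ₁ (x : DihC3C3) : ZMod 3 := x.a
/-- Coordinate `κ₂ (a, b, s) = b`. [folklore] -/
def κ₂ (x : DihC3C3) : ZMod 3 := x.b
/-- Sign `ε (a, b, s) = (−1)^s`. [folklore] -/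
def ε (x : DihC3C3) : ZMod 3 := sgn x.s

/-- `Dih(C₃²)` has coordinates (`c₁ = (1,0,0)`, `c₂ = (0,1,0)`). [folklore] -/
theorem coord2 : Coord2 (⟨1, 0, 0⟩ : DihC3C3) ⟨0, 1, 0⟩ κ₁ κ₂ ε := by
  unfold Coord2 InK2; decide +kernel

end DihC3C3

namespace DihC3C3

/-- Decoding of an element index `i < 18` of `Dih(C₃²)`: `(i mod 3, ⌊i/3⌋ mod 3, ⌊i/9⌋)`. [folklore] -/
def dec1 (i : ℕ) : DihC3C3 := ⟨(i % 3 : ℕ), (i / 3 % 3 : ℕ), (i / 9 % 2 : ℕ)⟩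

/-- The multiplication of `Dih(C₃²)` on triples. [folklore] -/
theorem mul_def (x y : DihC3C3) : x * y = ⟨x.a + sgn x.s * y.a, x.b + sgn x.s * y.b, x.s + y.s⟩ := rfl

end DihC3C3

/-! ### Kernel-friendly Boolean checks of a cell list, and the `32`-cell witness of `Dih(C₃²)` -/

section BoolChecks

variable {G : Type*} [DecidableEq G]

/-- Boolean independence check of a list of cells: distinct cells have word `E2 P P' ≠ 1` (kernel-friendly form). [folklore] -/
def indepB [Group G] (l : List (G × G × G)) : Bool := l.all fun P => l.all fun P' => decide (P = P' ∨ E2 P P' ≠ 1)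

/-- The Boolean check gives independence of the cell set `l.toFinset`. [folklore] -/
theorem indep_of_indepB [Group G] {l : List (G × G × G)} (h : indepB l = true) :
    ∀ P ∈ l.toFinset, ∀ P' ∈ l.toFinset, P ≠ P' → E2 P P' ≠ 1 := by
  intro P hP P' hP' hne
  simp only [indepB, List.all_eq_true, decide_eq_true_eq] at h
  exact (h P (List.mem_toFinset.1 hP) P' (List.mem_toFinset.1 hP')).resolve_left hne

/-- Boolean box check: every listed cell has second coordinate in `Y` and third in `W`. [folklore] -/
def inBoxB (l : List (G × G × G)) (Y W : Finset G) : Bool := l.all fun P => decide (P.2.1 ∈ Y ∧ P.2.2 ∈ W)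

/-- The Boolean box check gives `l.toFinset ⊆ G × Y × W`. [folklore] -/
theorem subset_box_of_inBoxB [Fintype G] {l : List (G × G × G)} {Y W : Finset G} (h : inBoxB l Y W = true) :
    l.toFinset ⊆ univ ×ˢ (Y ×ˢ W) := by
  intro P hP
  simp only [inBoxB, List.all_eq_true, decide_eq_true_eq] at h
  obtain ⟨h1, h2⟩ := h P (List.mem_toFinset.1 hP)
  simp only [mem_product, mem_univ, true_and]
  exact ⟨h1, h2⟩

/-- Cells from codes `x + n·y + n²·w` through a decoder of element indices. [folklore] -/
def cellsOfCodes (n : ℕ) (dec : ℕ → G) (codes : List ℕ) : List (G × G × G) :=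
  codes.map fun c => (dec (c % n), dec (c / n % n), dec (c / (n * n)))

end BoolChecks

/-- Engine witness for `Dih(C₃²)` (order `18`): `32` cells as codes `x + 18y + 324w`, box `Y = {0,1,3}`, `W = {0,4,9}`. [folklore] -/
def witnessCodes18 : List ℕ :=
  [2916, 2934, 54, 1350, 1297, 2935, 1316, 2937, 2973, 1354, 2921, 2975, 6, 1302, 25, 1321, 2925, 2943, 63, 1359,
    1306, 2944, 1325, 2946, 2982, 1363, 2930, 2984, 15, 1311, 34, 1330]


set_option maxHeartbeats 4000000 in
/-- **`α(Dih(C₃²); 18, 3, 3) ≥ 32`**: the engine's witness, an independent `32`-cell set of the box `Y = {1, c₁, c₂}`,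
`W = {1, c₁c₂, t}` (kernel-checked). [folklore] -/
theorem DihC3C3.exists_indep_32 :
    ∃ (Y W : Finset DihC3C3) (I : Finset (DihC3C3 × DihC3C3 × DihC3C3)), #Y = 3 ∧ #W = 3 ∧
      I ⊆ univ ×ˢ (Y ×ˢ W) ∧ (∀ P ∈ I, ∀ P' ∈ I, P ≠ P' → E2 P P' ≠ 1) ∧ #I = 32 :=
  ⟨{DihC3C3.dec1 0, DihC3C3.dec1 1, DihC3C3.dec1 3}, {DihC3C3.dec1 0, DihC3C3.dec1 4, DihC3C3.dec1 9},
    (cellsOfCodes 18 DihC3C3.dec1 witnessCodes18).toFinset, by decide +kernel, by decide +kernel,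
    subset_box_of_inBoxB (by decide +kernel), indep_of_indepB (by decide +kernel), by decide +kernel⟩

/-! ### Lifting an independent cell set along a surjective homomorphism -/

/-- The word `E2` is mapped componentwise by a homomorphism. [folklore] -/
theorem map_E2 {G Q : Type*} [Group G] [Group Q] (f : G →* Q) (P P' : G × G × G) :
    f (E2 P P') = E2 (f P.1, (f P.2.1, f P.2.2)) (f P'.1, (f P'.2.1, f P'.2.2)) := by
  simp [E2, map_mul, map_inv]

/-- **Lift of an independent cell set along a surjection.** If `f : G → Q` is a surjective homomorphism and `I ⊆ Q × Y × W` is an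
independent cell set, then `G` has a box `Y' × W'` of the same side sizes carrying an independent cell set of `|I| · |ker f|`
cells (all `(σ q · n, σ ȳ, σ w̄)`, `n ∈ ker f`, over a section `σ`). [folklore] -/
theorem exists_indep_lift {G Q : Type*} [Group G] [Group Q] [Fintype G] [DecidableEq G] [Fintype Q] [DecidableEq Q]
    (f : G →* Q)
    (hf : Function.Surjective f) {Y W : Finset Q} {I : Finset (Q × Q × Q)} (hI : I ⊆ univ ×ˢ (Y ×ˢ W))
    (hind : ∀ P ∈ I, ∀ P' ∈ I, P ≠ P' → E2 P P' ≠ 1) :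
    ∃ (Y' W' : Finset G) (J : Finset (G × G × G)), #Y' = #Y ∧ #W' = #W ∧ J ⊆ univ ×ˢ (Y' ×ˢ W') ∧
      (∀ P ∈ J, ∀ P' ∈ J, P ≠ P' → E2 P P' ≠ 1) ∧ #J = #I * Nat.card f.ker := by
  classical
  haveI : Fintype ↥f.ker := Fintype.ofFinite _
  set σ : Q → G := Function.surjInv hf with hσdef
  have hσ : ∀ q, f (σ q) = q := Function.surjInv_eq hf
  have σinj : Function.Injective σ := Function.injective_surjInv hf
  have hfN : ∀ n : ↥f.ker, f (n : G) = 1 := fun n => (MonoidHom.mem_ker).1 n.2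
  have hflift : ∀ (q : Q) (n : ↥f.ker), f (σ q * (n : G)) = q := fun q n => by rw [map_mul, hσ, hfN, mul_one]
  let emb : Q ↪ G := ⟨σ, σinj⟩
  let lift : (Q × Q × Q) × ↥f.ker → G × G × G := fun p => (σ p.1.1 * (p.2 : G), (σ p.1.2.1, σ p.1.2.2))
  have lift_inj : Set.InjOn lift ↑(I ×ˢ (univ : Finset ↥f.ker)) := by
    rintro ⟨c, n⟩ - ⟨c', n'⟩ - heq
    simp only [lift, Prod.mk.injEq] at heq
    obtain ⟨h1, h2, h3⟩ := heq
    have hq : c.1 = c'.1 := by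
      have := congrArg f h1; rwa [hflift, hflift] at this
    have hn : n = n' := by
      rw [hq] at h1; exact Subtype.ext (mul_left_cancel h1)
    exact Prod.ext (Prod.ext hq (Prod.ext (σinj h2) (σinj h3))) hn
  set J : Finset (G × G × G) := (I ×ˢ (univ : Finset ↥f.ker)).image lift with hJ
  refine ⟨Y.map emb, W.map emb, J, card_map _, card_map _, ?_, ?_, ?_⟩
  · intro P hP
    obtain ⟨⟨c, n⟩, hcn, rfl⟩ := mem_image.1 hP
    rw [mem_product] at hcn
    have hc := hI hcn.1
    simp only [mem_product, mem_univ, true_and] at hc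
    simp only [lift, mem_product, mem_univ, true_and, mem_map, Function.Embedding.coeFn_mk, emb]
    exact ⟨⟨c.2.1, hc.1, rfl⟩, ⟨c.2.2, hc.2, rfl⟩⟩
  · intro P hP P' hP' hne hw
    obtain ⟨⟨c, n⟩, hcn, rfl⟩ := mem_image.1 hP
    obtain ⟨⟨c', n'⟩, hcn', rfl⟩ := mem_image.1 hP'
    rw [mem_product] at hcn hcn'
    have hproj : E2 c c' = 1 := by
      have := congrArg f hw
      rw [map_E2, map_one] at this
      simpa only [lift, hflift, hσ] using this
    by_cases hcc : c = c'
    · subst hcc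
      have hnn : n ≠ n' := by rintro rfl; exact hne rfl
      apply hnn
      have : σ c.1 * (n : G) * (σ c.1 * (n' : G))⁻¹ = 1 := by simpa [lift, E2] using hw
      have h2 : (n : G) = (n' : G) := mul_left_cancel (mul_inv_eq_one.1 this)
      exact Subtype.ext h2
    · exact hind c hcn.1 c' hcn'.1 hcc hproj
  · rw [hJ, card_image_of_injOn lift_inj, card_product, card_univ, Nat.card_eq_fintype_card]


/-! ### The coordinates as a homomorphism onto `Dih(C₃²)`; the lower bound -/

namespace Coord2

variable {G : Type*} [Group G] {c₁ c₂ : G} {κ₁ κ₂ ε : G → ZMod 3} (h : Coord2 c₁ c₂ κ₁ κ₂ ε)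
include h

/-- Coordinates of `c₁^a c₂^b`: `κ₁ = a`, `κ₂ = b`, `ε = 1`. [folklore] -/
theorem kap_pow_pow (a b : ℕ) : κ₁ (c₁ ^ a * c₂ ^ b) = (a : ZMod 3) ∧ κ₂ (c₁ ^ a * c₂ ^ b) = (b : ZMod 3) ∧
    ε (c₁ ^ a * c₂ ^ b) = 1 := by
  have e1 : ∀ a : ℕ, κ₁ (c₁ ^ a) = (a : ZMod 3) ∧ κ₂ (c₁ ^ a) = 0 ∧ ε (c₁ ^ a) = 1 := by
    intro a; induction a with
    | zero => simp [h.kap1_one, h.kap2_one, ← h.eps_one₂]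
    | succ k ih => rw [pow_succ, h.kap1_mul, h.kap2_mul, h.eps_mul, ih.1, ih.2.1, ih.2.2, h.kap1_c1, h.kap2_c1, h.eps_c1]; simp
  have e2 : ∀ b : ℕ, κ₁ (c₂ ^ b) = 0 ∧ κ₂ (c₂ ^ b) = (b : ZMod 3) ∧ ε (c₂ ^ b) = 1 := by
    intro b; induction b with
    | zero => simp [h.kap1_one, h.kap2_one, ← h.eps_one₂]
    | succ k ih => rw [pow_succ, h.kap1_mul, h.kap2_mul, h.eps_mul, ih.1, ih.2.1, ih.2.2, h.kap1_c2, h.kap2_c2, h.eps_c2]; simp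
  rw [h.kap1_mul, h.kap2_mul, h.eps_mul, (e1 a).1, (e1 a).2.1, (e1 a).2.2, (e2 b).1, (e2 b).2.1, (e2 b).2.2]; simp

/-- The coordinate map `g ↦ (κ₁ g, κ₂ g, [ε g = −1])` into `Dih(C₃²)`. [folklore] -/
def toDih (_h : Coord2 c₁ c₂ κ₁ κ₂ ε) (g : G) : DihC3C3 := ⟨κ₁ g, κ₂ g, if ε g = 1 then 0 else 1⟩

/-- Unfolding `toDih`. [folklore] -/
theorem toDih_apply (g : G) : h.toDih g = ⟨κ₁ g, κ₂ g, if ε g = 1 then 0 else 1⟩ := rfl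

/-- The sign coordinate read in `Dih(C₃²)`: `sgn [ε g = −1] = ε g`. [folklore] -/
theorem sgn_toDih (g : G) : DihC3C3.sgn (if ε g = 1 then 0 else 1) = ε g := by
  rcases h.sign g with e | e
  · rw [e, if_pos rfl]; decide
  · rw [e, if_neg (by decide)]; decide

/-- The coordinate map is multiplicative (the cocycle law is the semidirect multiplication). [folklore] -/
theorem toDih_mul (g k : G) : h.toDih (g * k) = h.toDih g * h.toDih k := by
  rw [toDih_apply, toDih_apply, toDih_apply, DihC3C3.mul_def]
  simp only [DihC3C3.mk.injEq]
  refine ⟨by rw [h.kap1_mul, h.sgn_toDih], by rw [h.kap2_mul, h.sgn_toDih], ?_⟩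
  rw [h.eps_mul]
  rcases h.sign g with e | e <;> rcases h.sign k with f | f <;> rw [e, f] <;> decide

/-- The coordinate homomorphism `π : G →* Dih(C₃²)`. [folklore] -/
def toDihHom (h : Coord2 c₁ c₂ κ₁ κ₂ ε) : G →* DihC3C3 :=
  MonoidHom.mk' h.toDih h.toDih_mul

/-- `π` is surjective as soon as some element has sign `−1`. [folklore] -/
theorem toDihHom_surjective {t : G} (ht : ε t = -1) : Function.Surjective h.toDihHom := by
  have hm1 : (-1 : ZMod 3) ≠ 1 := by decide
  rintro ⟨a, b, s⟩
  fin_cases s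
  · refine ⟨c₁ ^ a.val * c₂ ^ b.val, ?_⟩
    obtain ⟨k1, k2, k3⟩ := h.kap_pow_pow a.val b.val
    show h.toDih _ = _
    rw [toDih_apply, k1, k2, k3, ZMod.natCast_zmod_val, ZMod.natCast_zmod_val, if_pos rfl]
    rfl
  · refine ⟨c₁ ^ (a - κ₁ t).val * c₂ ^ (b - κ₂ t).val * t, ?_⟩
    obtain ⟨k1, k2, k3⟩ := h.kap_pow_pow (a - κ₁ t).val (b - κ₂ t).val
    have e3 : ε (c₁ ^ (a - κ₁ t).val * c₂ ^ (b - κ₂ t).val * t) = -1 := by rw [h.eps_mul, k3, ht, one_mul]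
    show h.toDih _ = _
    rw [toDih_apply, h.kap1_mul, h.kap2_mul, k1, k2, k3, e3, ZMod.natCast_zmod_val, ZMod.natCast_zmod_val, one_mul, one_mul,
      if_neg hm1, sub_add_cancel, sub_add_cancel]
    rfl

/-- `|ker π| · 18 = |G|` when `π` is onto. [folklore] -/
theorem card_ker_mul [Fintype G] {t : G} (ht : ε t = -1) : Nat.card h.toDihHom.ker * 18 = Fintype.card G := by
  have hidx : h.toDihHom.ker.index = 18 := by
    rw [Subgroup.index_ker, MonoidHom.range_eq_top_of_surjective _ (h.toDihHom_surjective ht), Subgroup.card_top,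
      Nat.card_eq_fintype_card]; rfl
  rw [← hidx, Subgroup.card_mul_index, Nat.card_eq_fintype_card]

/-- In a `𝒞₂` group, two elements of sign `+1` commute; so a NON-COMMUTING pair exhibits an element of sign `−1`. [folklore] -/
theorem exists_eps_neg_of_ne {a b : G} (hab : a * b ≠ b * a) : ∃ t, ε t = -1 := by
  by_contra hne
  have hne' : ∀ t, ε t ≠ -1 := fun t ht => hne ⟨t, ht⟩
  have ha : ε a = 1 := (h.sign a).resolve_right (hne' a)
  have hb : ε b = 1 := (h.sign b).resolve_right (hne' b)
  obtain ⟨u, hu, e⟩ := h.comm a b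
  have hba : ε (b * a) = 1 := by rw [h.eps_mul, hb, ha, mul_one]
  have k1 : κ₁ u = 0 := by
    have e1 := congrArg κ₁ e
    rw [h.kap1_mul, h.kap1_mul (b * a), h.kap1_mul, ha, hb, hba] at e1
    linear_combination -e1
  have k2 : κ₂ u = 0 := by
    have e2 := congrArg κ₂ e
    rw [h.kap2_mul, h.kap2_mul (b * a), h.kap2_mul, ha, hb, hba] at e2
    linear_combination -e2
  rw [h.inK_eq_one hu k1 k2, mul_one] at e
  exact hab e

/-- **Lower bound: the box ratio of a non-abelian `𝒞₂` group is at least `16/9`.** With an element of sign `−1` there is a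
`3 × 3` box carrying an independent cell set `J` with `9|J| = 16|G|`: the `32`-cell witness of `Dih(C₃²)` lifted along `π`
(`32 · |ker π| = 32·|G|/18`). [folklore] -/
theorem exists_indep_sixteen_ninths [Fintype G] [DecidableEq G] {t : G} (ht : ε t = -1) :
    ∃ (Y W : Finset G) (J : Finset (G × G × G)), #Y = 3 ∧ #W = 3 ∧ J ⊆ univ ×ˢ (Y ×ˢ W) ∧
      (∀ P ∈ J, ∀ P' ∈ J, P ≠ P' → E2 P P' ≠ 1) ∧ 9 * #J = 16 * Fintype.card G := by
  classical
  obtain ⟨Y, W, I, hY, hW, hI, hind, hcard⟩ := DihC3C3.exists_indep_32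
  obtain ⟨Y', W', J, hY', hW', hJ, hJind, hJcard⟩ := exists_indep_lift h.toDihHom (h.toDihHom_surjective ht) hI hind
  refine ⟨Y', W', J, hY'.trans hY, hW'.trans hW, hJ, hJind, ?_⟩
  have hk := h.card_ker_mul ht
  rw [hJcard, hcard]
  omega

/-- The lower bound from a non-commuting pair. [folklore] -/
theorem exists_indep_sixteen_ninths_of_ne [Fintype G] [DecidableEq G] {a b : G} (hab : a * b ≠ b * a) :
    ∃ (Y W : Finset G) (J : Finset (G × G × G)), #Y = 3 ∧ #W = 3 ∧ J ⊆ univ ×ˢ (Y ×ˢ W) ∧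
      (∀ P ∈ J, ∀ P' ∈ J, P ≠ P' → E2 P P' ≠ 1) ∧ 9 * #J = 16 * Fintype.card G := by
  obtain ⟨t, ht⟩ := h.exists_eps_neg_of_ne hab
  exact h.exists_indep_sixteen_ninths ht

end Coord2

end Summit.MatrixMultiplication.OmegaCensus.DihC3Sq
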